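import Summits.QuantumFields.YangMills.Theorems.BalabanUVNodesN15KingModelToronEffectiveLaplacian
import HarnessLib

/-!
# BalabanUVNodes ∕ N15 — THE KING-MODEL RUNG (PART Ͷ-l): NE2's ANALOGUE AT A LIVE FLAT LINK FIELD — KING's LEMMA 4.3 ∕ PROPOSITION 3.10 (3.91) FOR THE TORON EFFECTIVE LAPLACIANS,
# BY NAME: `|Δ^{(k)}_ω(p′) − Δ^{(k+n)}_{ω′}(p′)| ≤ 2a_k(a_n⁻¹ + π²∕48 + 1∕3)·L^{−2k}·Δ^{(k)}_ω(p′)` for the level-`k` and level-`(k+n)` toron effective Laplacians WITH THE SAME HOLONOMY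
# (phases `φ` per level-`k` fine bond, `φ∕L^n` per level-`(k+n)` fine bond), mode by mode — the tree's `King1986.lemma43_aK` (arbitrary real momenta) at the SHIFTED momentum `s′ = p′ + L^kφ`
# (Track A, DAG node N15 = NE2 «η-rates of the covariance pieces»; FAN-OUT v1.1 §N15 s3 «KING-MODEL RUNG … NE2's analogue DECIDED in the model … + what the curved case adds»; count-neutral)

HONEST FRAMING.  Count-neutral (cell `pub-ymgap`, seat `pub-ymgap-dag-n15-e` g44; `--supports stmt-QuantumFields-27247 --as helper` = K3ᴬ, KEY MAP v3).  King's scalar block-spin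
model [King1986] with the COVARIANT block mean at a constant abelian (flat) link field (PART Ͷ-k); two fine tori `Π_μℤ∕(L^kM_μ)` and `Π_μℤ∕(L^{k+n}M_μ)` over the same unit torus
`Π_μℤ∕M_μ`, with the SAME physical holonomy; King's constants `a_k = aK a L k` ((2.13)).  The rate is King's Lemma 4.3 ∕ Prop. 3.10 (3.91) p.669 — the unit-lattice effective
Laplacian converges at rate `L^{−2k}` — the tree proved it for the symbols at ARBITRARY real momenta (`King1986.CompositionLaw.lemma43_aK`), so at a toron it holds VERBATIM at the
shifted momentum; the only input from PART Ͷ is the operator identification `(Δ^ω_eff g)^(p′) = DeltaEff a_k L^k m² s′·ĝ(p′)` (Ͷ-k `dft_effLapTw_apply_eq_DeltaEff`).  NOT Bałaban's vector-field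
`G_k(U)` ∕ [Balaban1985BackgroundPropagators] (3.42); NOT a node discharge; nothing continuum-YM ∕ ℝ⁴ ∕ OS ∕ Clay.

THE RESULTS (`L ≥ 2`, `k, n ≥ 1`, `a > 0`, `m² > 0`; coarse momentum `q`, phases `φ` with the shifted momentum `s′ = p′(q) + L^kφ` in the Brillouin zone `|s′_μ| ≤ π` and `s′ ≠ 0`):
* `sOfTw_refine` (the level-`(k+n)` phases `φ∕L^n` give the SAME shifted momentum — the holonomy is the physical datum); `toronEffSymbol` ∕ `toronEffSymbol_eq` (the common real multiplier
  `Δ^{(k)}_ω(p′) = DeltaEff a_k L^k m² s′`);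
* ★★★ **`king_lemma43_toron`** — `|Δ^{(k)}_ω(p′) − Δ^{(k+n)}_{ω′}(p′)| ≤ a_k·2(a_n⁻¹ + π²∕48 + 1∕3)·L^{−2k}·Δ^{(k)}_ω(p′)` (the symbols; `lemma43_aK` at `s′`);
* ★★★ **`king_prop310_toron_dft`** — the same for the OPERATORS of PART Ͷ-k on test functions: `‖(Δ^{(k)}_ω g)^(p′) − (Δ^{(k+n)}_{ω′} g)^(p′)‖ ≤ a_k·2(…)·L^{−2k}·Δ^{(k)}_ω(p′)·‖ĝ(p′)‖`;
* ★★ `king_prop310_toron_uniform` (`0 < Δ^{(k)}_ω(p′) ≤ a_k ≤ a`: the (3.91) companion «|Δ^{(k)}(p)| ≤ C uniformly in k», `DeltaEff_pos`∕`DeltaEff_le`∕`aK_le` by name).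

PRIOR TREE ART (by name, not restated): Ͷ-k (`effLapTw`, `sigTw`, `dft_effLapTw_apply_eq_DeltaEff`, `effLapTw_symbol_pos`), `King1986.CompositionLaw` (`DeltaEff`, `lemma43_aK`, `DeltaEff_le`,
`DeltaEff_pos`), `King1986.EffectiveLaplacianRate` (`aK`, `aK_pos`, `aK_le`, `momSq`), `B5ToronMomentum161` (`sOfTw`, `twistOf`), `B5Prop11Plancherel` (`dft`, `fine`, `sOf`).  Dedup (rg at filing):
basename 0 files; needles `king_lemma43_toron|king_prop310_toron|toronEffSymbol|sOfTw_refine` 0 tree files.  Locators: [King1986] Prop. 3.10 (3.91) p.669, Lemma 4.3 (4.18) p.672, (4.5)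
p.670, (2.13) p.653; [Balaban1985BackgroundPropagators] (3.19) p.393; [tHooft1979Flux] NPB 153 (notion only).  0 `sorry`, 1 `def`.
-/

noncomputable section

open scoped BigOperators ComplexConjugate
open Finset Matrix Complex

namespace Summit.QuantumFields.YangMills.BalabanUVNodes.N15KingModelRung.Toron

open Literature.MathematicalPhysics.QuantumFieldTheory.Balaban1983to89.B5Prop11Plancherel
open Literature.MathematicalPhysics.QuantumFieldTheory.Balaban1983to89.B5ToronMomentum161 (sOfTw twistOf)
open Literature.MathematicalPhysics.QuantumFieldTheory.King1986 (DeltaEff aK aK_pos aK_le momSq lemma43_aK DeltaEff_le DeltaEff_pos)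

variable {d : ℕ} (M : Fin (d + 1) → ℕ) [hM : ∀ μ, NeZero (M μ)]

omit hM in
/-- REFINING THE LATTICE AT FIXED HOLONOMY DOES NOT MOVE THE SHIFTED MOMENTUM: with `L^n·L^k` fine points per unit and phases `φ∕L^n` per fine bond, `s′ = p′ + L^{k+n}·(φ∕L^n) = p′ + L^kφ`.
[cite: King1986, (4.3) p.670; tHooft1979Flux, NPB 153 (twisted boundary conditions)] -/
theorem sOfTw_refine (L k n : ℕ) (hL : L ≠ 0) (φ : Fin (d + 1) → ℝ) (q : Tor M) :
    sOfTw (L ^ n * L ^ k) M (fun μ => φ μ / (L : ℝ) ^ n) q = sOfTw (L ^ k) M φ q := by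
  funext μ
  simp only [sOfTw, Pi.add_apply]
  have hLn : ((L : ℝ)) ^ n ≠ 0 := pow_ne_zero _ (by exact_mod_cast hL)
  push_cast
  field_simp

/-- THE TORON EFFECTIVE SYMBOL at level `k`: King's `Δ^{(k)} = DeltaEff a_k L^k m²` at the shifted momentum `s′ = p′(q) + L^kφ`. [cite: King1986, (4.5) p.670] -/
def toronEffSymbol (a : ℝ) (L k : ℕ) (m2 : ℝ) (φ : Fin (d + 1) → ℝ) (q : Tor M) : ℝ := DeltaEff (aK a L k) (L ^ k) m2 (sOfTw (L ^ k) M φ q)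

/-- The toron effective symbol IS the Fourier multiplier of PART Ͷ-k's operator `effLapTw` at level `k` (`c = (L^k)²`, `a_k = aK a L k`; Brillouin zone of `s′`).
[cite: King1986, (4.5) p.670, (2.13)-(2.14) p.653] -/
theorem toronEffSymbol_eq {a : ℝ} (ha : 0 < a) {L k : ℕ} (hL : 2 ≤ L) (hk : 1 ≤ k) {m2 : ℝ} (hm : 0 < m2) (φ : Fin (d + 1) → ℝ) (g : Tor M → ℂ) (q : Tor M)
    (hzone : ∀ μ, |sOfTw (L ^ k) M φ q μ| ≤ Real.pi) :
    haveI : NeZero (L ^ k) := ⟨pow_ne_zero k (by omega)⟩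
    (dft M *ᵥ (effLapTw (L ^ k) M (aK a L k) (((L ^ k : ℕ) : ℝ) ^ 2) m2 (twistOf φ) *ᵥ g)) q = ((toronEffSymbol M a L k m2 φ q : ℝ) : ℂ) * (dft M *ᵥ g) q := by
  haveI : NeZero (L ^ k) := ⟨pow_ne_zero k (by omega)⟩
  have hL1 : (1 : ℝ) < L := by exact_mod_cast hL
  exact dft_effLapTw_apply_eq_DeltaEff (L ^ k) M (aK_pos ha hL1 hk) hm φ g q hzone

omit hM in
/-- ★★★ **KING's LEMMA 4.3 ∕ PROP. 3.10 (3.91) AT A TORON (symbols)**: for `L ≥ 2`, `k, n ≥ 1`, `a > 0`, `m² ≥ 0`, every coarse momentum `q` and phases `φ` with `s′ = p′(q) + L^kφ` in the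
Brillouin zone and non-zero: `|Δ^{(k)}_ω(p′) − Δ^{(k+n)}_{ω′}(p′)| ≤ a_k·2(a_n⁻¹ + π²∕48 + 1∕3)·L^{−2k}·Δ^{(k)}_ω(p′)`, the level-`(k+n)` toron carrying the SAME holonomy (phases `φ∕L^n`) —
the tree's `lemma43_aK` at `s′`. [cite: King1986, Lemma 4.3 (4.18) p.672, Prop. 3.10 (3.91) p.669] -/
theorem king_lemma43_toron {a : ℝ} (ha : 0 < a) {L k n : ℕ} (hL : 2 ≤ L) (hk : 1 ≤ k) (hn : 1 ≤ n) {m2 : ℝ} (hm : 0 ≤ m2) (φ : Fin (d + 1) → ℝ) (q : Tor M)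
    (hzone : ∀ μ, |sOfTw (L ^ k) M φ q μ| ≤ Real.pi) (hq0 : 0 < momSq (sOfTw (L ^ k) M φ q)) :
    |toronEffSymbol M a L k m2 φ q - toronEffSymbol M a L (k + n) m2 (fun μ => φ μ / (L : ℝ) ^ n) q|
      ≤ aK a L k * (2 * (((aK a L n)⁻¹ + Real.pi ^ 2 / 48 + 1 / 3) * (((L ^ k : ℕ) : ℝ) ^ 2)⁻¹)) * toronEffSymbol M a L k m2 φ q := by
  unfold toronEffSymbol
  rw [pow_add, mul_comm (L ^ k) (L ^ n), sOfTw_refine M L k n (by omega) φ q]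
  exact lemma43_aK ha hL hk hn hm hzone hq0

/-- ★★★ **PROP. 3.10 (3.91) AT A TORON FOR THE OPERATORS** (PART Ͷ-k's `effLapTw` at levels `k` and `k+n` with the same holonomy; `a > 0`, `m² > 0`): on every test function `g` and every
coarse mode in the zone with `s′ ≠ 0`, `‖(Δ^{(k)}_ω g)^(p′) − (Δ^{(k+n)}_{ω′} g)^(p′)‖ ≤ a_k·2(a_n⁻¹ + π²∕48 + 1∕3)·L^{−2k}·Δ^{(k)}_ω(p′)·‖ĝ(p′)‖`.
[cite: King1986, Prop. 3.10 (3.91) p.669, Lemma 4.3 (4.18) p.672, (4.5) p.670] -/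
theorem king_prop310_toron_dft {a : ℝ} (ha : 0 < a) {L k n : ℕ} (hL : 2 ≤ L) (hk : 1 ≤ k) (hn : 1 ≤ n) {m2 : ℝ} (hm : 0 < m2) (φ : Fin (d + 1) → ℝ) (g : Tor M → ℂ) (q : Tor M)
    (hzone : ∀ μ, |sOfTw (L ^ k) M φ q μ| ≤ Real.pi) (hq0 : 0 < momSq (sOfTw (L ^ k) M φ q)) :
    haveI : NeZero (L ^ k) := ⟨pow_ne_zero k (by omega)⟩
    haveI : NeZero (L ^ (k + n)) := ⟨pow_ne_zero (k + n) (by omega)⟩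
    ‖(dft M *ᵥ (effLapTw (L ^ k) M (aK a L k) (((L ^ k : ℕ) : ℝ) ^ 2) m2 (twistOf φ) *ᵥ g)) q
        - (dft M *ᵥ (effLapTw (L ^ (k + n)) M (aK a L (k + n)) (((L ^ (k + n) : ℕ) : ℝ) ^ 2) m2 (twistOf fun μ => φ μ / (L : ℝ) ^ n) *ᵥ g)) q‖
      ≤ aK a L k * (2 * (((aK a L n)⁻¹ + Real.pi ^ 2 / 48 + 1 / 3) * (((L ^ k : ℕ) : ℝ) ^ 2)⁻¹)) * toronEffSymbol M a L k m2 φ q * ‖(dft M *ᵥ g) q‖ := by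
  haveI : NeZero (L ^ k) := ⟨pow_ne_zero k (by omega)⟩
  haveI : NeZero (L ^ (k + n)) := ⟨pow_ne_zero (k + n) (by omega)⟩
  have hzone' : ∀ μ, |sOfTw (L ^ (k + n)) M (fun μ => φ μ / (L : ℝ) ^ n) q μ| ≤ Real.pi := fun μ => by
    rw [pow_add, mul_comm (L ^ k) (L ^ n), sOfTw_refine M L k n (by omega)]; exact hzone μ
  rw [toronEffSymbol_eq M ha hL hk hm φ g q hzone, toronEffSymbol_eq M ha hL (by omega) hm _ g q hzone', ← sub_mul, norm_mul, ← Complex.ofReal_sub, Complex.norm_real, Real.norm_eq_abs]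
  exact mul_le_mul_of_nonneg_right (king_lemma43_toron M ha hL hk hn hm.le φ q hzone hq0) (norm_nonneg _)

omit hM in
/-- ★★ **(3.91)'s COMPANION «`|Δ^{(k)}(p)| ≤ C` UNIFORMLY IN `k`» AT THE TORON**: `0 < Δ^{(k)}_ω(p′) ≤ a_k ≤ a` (`DeltaEff_pos`, `DeltaEff_le`, `aK_le` by name; `a > 0`, `m² ≥ 0`, `L ≥ 2`,
`k ≥ 1`, zone, `s′ ≠ 0`). [cite: King1986, Prop. 3.10 p.669, proof of Lemma 4.1 p.671] -/
theorem king_prop310_toron_uniform {a : ℝ} (ha : 0 < a) {L k : ℕ} (hL : 2 ≤ L) (hk : 1 ≤ k) {m2 : ℝ} (hm : 0 ≤ m2) (φ : Fin (d + 1) → ℝ) (q : Tor M)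
    (hzone : ∀ μ, |sOfTw (L ^ k) M φ q μ| ≤ Real.pi) (hq0 : 0 < momSq (sOfTw (L ^ k) M φ q)) :
    0 < toronEffSymbol M a L k m2 φ q ∧ toronEffSymbol M a L k m2 φ q ≤ aK a L k ∧ aK a L k ≤ a := by
  have hL1 : (1 : ℝ) < L := by exact_mod_cast hL
  have hak := aK_pos ha hL1 hk
  exact ⟨DeltaEff_pos hak (Nat.one_le_pow k L (by omega)) hm hzone hq0, DeltaEff_le hak _ hm _, aK_le ha hL1 hk⟩

end Summit.QuantumFields.YangMills.BalabanUVNodes.N15KingModelRung.Toron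

end
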